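import Literature.MathematicalPhysics.QuantumFieldTheory.Balaban1983to89.HaarEigenvalueSphereNull
import HarnessLib

/-!
# `Balaban1983to89.HaarDist1LevelHypersurface` — THE `dist1`-SPHERE `{‖U − 1‖ = r}` OF `U(N)` LIES ON ONE REAL-ANALYTIC
# HYPERSURFACE `{det((r² − 2)·1 + U + Uᴴ) = 0}`; centred spheres and countable threshold families are Haar-null

Kernel matrix analysis ∕ measure bookkeeping on the cell's gauge groups; tags [HornJohnson2013] (spectral norm = top
eigenvalue), [Balaban1985Averaging] (19) p. 21 (`|U − 1|` = operator norm), [BrockerTomDieck1985] IV (2.11) (proof principle: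
analytic level sets are Haar-null); nothing of Bałaban's analysis is asserted.  Cell `pub-ymgap` (DAG node N09 [Balaban1987RG1];
seat `pub-ymgap-dag-n09-w3` g3, the HAND of seat `pub-ymgap-dag-n09-w1` g4 of 2026-08-28T05:26:49Z), count-neutral helper
keyed to K1⁷ `stmt-QuantumFields-20542`.  RIDER to the landed `HaarEigenvalueSphereNull` (same directory), whose theorems
`haar_unitaryGroup_setOf_norm_sub_one_eq_eq_zero` ∕ `haar_specialUnitaryGroup_setOf_norm_sub_one_eq_eq_zero`
(`μ{g : ‖g − 1‖ = r} = 0`, `r ≠ 0`) are used BY NAME and not re-proved.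

WHY (the located debt this serves).  Seat `pub-ymgap-node00-def-K0e`'s audit `P7-LOCATOR-AUDIT.md` §4 (F2) «LEVEL-SET NULLITY:
`Haar{g ∈ SU(N) : dist1 g = r} = 0` … needed because the SHARP `𝟙_{domAlt_k}` is integrated over fibres» is a theorem for ONE
group variable (`HaarEigenvalueSphereNull`).  The record's OTHER sharp cut-offs — the (0.16) block-contour form
`Node00.chiFix016OfRecord` (thresholds on the loop variables `U(Γ ∪ [x,x′] ∪ (−Γ′) ∪ (−c))` of the averaging (0.4)) and the (2.17)
cube functions `chiOfRecord` — put the threshold `|W − 1| = r` on HOLONOMIES `W = W(U)`, i.e. on WORDS in many bond variables,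
and are reached by the product-Haar zero-set engine (seat `pub-ymgap-dag-n09-w2` g3, «real-analytic `F` on `(bonds → M_N(ℂ))`,
not identically zero on `SU(N)^{bonds}` ⇒ `dU{F = 0} = 0`») only through a REAL-ANALYTIC equation for the sphere: the operator
norm `W ↦ ‖W − 1‖` is not analytic, but (§1) for unitary `W`

  `‖W − 1‖ = r  ⟹  det((r² − 2)·1 + W + Wᴴ) = 0`,

and `M ↦ det(c·1 + M + Mᴴ)` is a polynomial in the entries of `M` and their conjugates, hence real-analytic, with value
`(c + 2)^N ≠ 0` at `M = 1` (§2).  §§3–4 add the two cheap corollaries of the one-variable theorem that the multi-scale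
bookkeeping wants: spheres about ANY centre, and COUNTABLE families of radii (all thresholds `ε₀L^{−2k}`, `ε_k`, `δ_k` at once).

THE ARGUMENT OF §1.  `H = (W − 1)ᴴ(W − 1)` is positive semidefinite with `‖H‖ = ‖W − 1‖²` (the C⋆-identity, Mathlib
`Matrix.l2_opNorm_conjTranspose_mul_self`), and the L²-operator norm of a positive semidefinite matrix is its largest eigenvalue
([HornJohnson2013] Thm. 4.2.2 (c); here from the orthonormal eigenbasis, the `ℂ`-twin of the tree's real
`Literature.Analysis.OperatorTheory.DiagonalCongruenceNormConvex` §4), so `det(‖W − 1‖²·1 − H) = 0`; for unitary `W`,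
`H = 2·1 − W − Wᴴ`.

WHAT IS PROVED (theorems only; 0 definitions, 0 sorry; axioms standard; the `[folklore]` plumbing is `private`).
* §1 (private: `toEuclideanCLM_apply_eigenvectorBasis`, `abs_eigenvalues_le_l2_opNorm`, `l2_opNorm_le_of_abs_eigenvalues_le`,
  `exists_abs_eigenvalues_eq_l2_opNorm`); PUBLIC ★ `exists_eigenvalues_eq_l2_opNorm_of_posSemidef` (Rayleigh–Ritz: some eigenvalue of
  a PSD matrix EQUALS `‖A‖`), `det_eigenvalues_smul_one_sub_eq_zero`, ★★ `det_normSq_smul_one_sub_conjTranspose_mul_self`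
  (`det(‖A‖²·1 − AᴴA) = 0`), ★★★ `det_level_eq_zero_of_norm_sub_one_eq` (unitary `W`, `‖W − 1‖ = r` ⇒ `det((r² − 2)·1 + W + Wᴴ) = 0`),
  `setOf_norm_sub_one_eq_subset_setOf_det_level` (set form for any unitary-valued map `w : X → M_N(ℂ)`).
* §2 (private: `det_eq_eval_mvPolynomialX`, `analyticOnNhd_det`); PUBLIC ★★ `analyticOnNhd_det_level` (`M ↦ det(c·1 + M + Mᴴ)` is
  real-analytic on `M_N(ℂ)`), `analyticOnNhd_det_level_comp` (so is `x ↦ det(c·1 + P x + (P x)ᴴ)` wherever `P` is),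
  `det_level_one_ne_zero` (`det(c·1 + 1 + 1ᴴ) = (c + 2)^N ≠ 0` for `c + 2 ≠ 0` — the «not identically zero» witness at `U ≡ 1`).
* §3 centred spheres: ★ `haar_unitaryGroup_setOf_norm_sub_eq_eq_zero` (`μ{u ∈ U(N) : ‖u − V‖ = r} = 0`, every centre `V ∈ U(N)`,
  every Haar `μ`, `r ≠ 0`), ★ `haar_specialUnitaryGroup_setOf_norm_sub_eq_eq_zero`.
* §4 countable families: ★ `haar_unitaryGroup_setOf_norm_sub_one_mem_eq_zero` ∕ ★ `haar_specialUnitaryGroup_setOf_norm_sub_one_mem_eq_zero`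
  (`μ{g : ‖g − 1‖ ∈ R} = 0`, `R` countable, `0 ∉ R`), and in the `GaugeGroup`∕`HaarData` currency of `UnitaryModel`:
  ★★ `haar_setOf_dist1_mem_eq_zero_specialUnitaryGroup : (HaarData.haar : Measure SU(n)) {g | dist1 g ∈ R} = 0`,
  `ae_forall_dist1_ne_specialUnitaryGroup` (a.e. `∀ r ∈ R, dist1 g ≠ r`), `haar_setOf_dist1_mem_eq_zero_unitaryGroup`.

HONEST SCOPE.  (i) §1 gives the INCLUSION sphere ⊆ hypersurface, not equality (the hypersurface is `{some eigenvalue at distance r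
from 1}`); that is what nullity transfer needs.  (ii) `N ≥ 1` for §1's determinant lemmas (for `N = 0` the empty determinant is `1`).
(iii) The norm is the L²-operator norm of the lineage (`Matrix.Norms.L2Operator`) = `dist1` of `UnitaryModel`; §§1–2 are otherwise
norm-free.  (iv) NOT HERE: the product-Haar engine (seat n09-w2 g3's `HaarAnalyticZeroSetNullPi` ∕ `FieldMeasureAnalyticZeroSetNull`), the
configuration-level threshold sets of `chiFix016OfRecord` ∕ `chiOfRecord` (a later Theorems file consuming both), (F1) (the Jacobian
face of (0.4)), (F3), the FIBRE reading of (F2) — the β-version proviso `hreg`∕`contTOn` stays displayed; N09 NOT discharged; the YM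
mass gap (Clay) is NOT proved by any of this (R4 = conditional finite-𝕋⁴ rung `BalabanLadder.UV` only).

References: R. A. Horn, C. R. Johnson, *Matrix Analysis*, 2nd ed. (2013) [HornJohnson2013] Thm. 4.2.2 (c), §5.6, §0.3, §1.2;
T. Bałaban, Commun. Math. Phys. **98** (1985) 17–51 [Balaban1985Averaging] (19) p. 21 (`|U − 1|` = operator norm); Th. Bröcker,
T. tom Dieck, *Representations of Compact Lie Groups*, GTM 98 (1985) [BrockerTomDieck1985] IV (2.11).
-/

noncomputable section

open NormedSpace Set Function Filter Topology MeasureTheory Complex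
open scoped ENNReal NNReal Matrix.Norms.L2Operator ComplexOrder

namespace Literature.MathematicalPhysics.QuantumFieldTheory.Balaban1983to89.HaarDist1LevelHypersurface

open HaarEigenvalueSphereNull (haar_unitaryGroup_setOf_norm_sub_one_eq_eq_zero
  haar_specialUnitaryGroup_setOf_norm_sub_one_eq_eq_zero)

variable {n : Type*} [Fintype n] [DecidableEq n]

/-! ## §1 The level equation of the `dist1`-sphere: `‖W − 1‖ = r ⟹ det((r² − 2)·1 + W + Wᴴ) = 0` -/

section Level

/-- The operator of a Hermitian matrix acts on the eigenvector basis by the eigenvalues: `op(A) b_j = λ_j b_j`. [folklore] -/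
private theorem toEuclideanCLM_apply_eigenvectorBasis {A : Matrix n n ℂ} (hA : A.IsHermitian) (j : n) :
    Matrix.toEuclideanCLM (n := n) (𝕜 := ℂ) A (hA.eigenvectorBasis j) =
      (hA.eigenvalues j : ℂ) • hA.eigenvectorBasis j := by
  refine PiLp.ext fun i => ?_
  have h := congrFun (hA.mulVec_eigenvectorBasis j) i
  rw [Pi.smul_apply, Complex.real_smul] at h
  rw [PiLp.smul_apply, smul_eq_mul, ← h]
  exact congrFun (Matrix.ofLp_toEuclideanCLM A _) i

/-- Every eigenvalue is bounded by the operator norm: `|λ_j(A)| ≤ ‖A‖` (test the norm on a unit eigenvector; the tree's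
`QuantumLattice.abs_eigenvalues_le_norm` states the same through `toEuclideanLin`). [folklore] -/
private theorem abs_eigenvalues_le_l2_opNorm {A : Matrix n n ℂ} (hA : A.IsHermitian) (j : n) :
    |hA.eigenvalues j| ≤ ‖A‖ := by
  have hv : ‖(hA.eigenvectorBasis j : EuclideanSpace ℂ n)‖ = 1 := hA.eigenvectorBasis.orthonormal.1 j
  have h := (Matrix.toEuclideanCLM (n := n) (𝕜 := ℂ) A).le_opNorm (hA.eigenvectorBasis j)
  rw [toEuclideanCLM_apply_eigenvectorBasis, norm_smul, Complex.norm_real, Real.norm_eq_abs, hv, mul_one, mul_one,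
    Matrix.l2_opNorm_toEuclideanCLM] at h
  exact h

/-- The operator norm is bounded by the largest `|eigenvalue|`: if `|λ_j(A)| ≤ C` for all `j` (`C ≥ 0`) then `‖A‖ ≤ C`
(expand in the orthonormal eigenbasis). [folklore] -/
private theorem l2_opNorm_le_of_abs_eigenvalues_le {A : Matrix n n ℂ} (hA : A.IsHermitian) {C : ℝ}
    (hC : 0 ≤ C) (h : ∀ j, |hA.eigenvalues j| ≤ C) : ‖A‖ ≤ C := by
  rw [← Matrix.l2_opNorm_toEuclideanCLM]
  refine ContinuousLinearMap.opNorm_le_bound _ hC fun x => ?_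
  set b := hA.eigenvectorBasis with hb
  set T := Matrix.toEuclideanCLM (n := n) (𝕜 := ℂ) A with hT
  have hTx : T x = ∑ j, ((hA.eigenvalues j : ℂ) * b.repr x j) • b j := by
    conv_lhs => rw [← b.sum_repr x]
    rw [map_sum]
    refine Finset.sum_congr rfl fun j _ => ?_
    rw [map_smul, hT, toEuclideanCLM_apply_eigenvectorBasis, smul_smul, mul_comm]
  set w : EuclideanSpace ℂ n := WithLp.toLp 2 (fun j => (hA.eigenvalues j : ℂ) * b.repr x j) with hw
  have hwj : ∀ j, w j = (hA.eigenvalues j : ℂ) * b.repr x j := fun j => rfl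
  have hTx' : T x = b.repr.symm w := by
    rw [hTx, ← b.sum_repr_symm]
  have hnorm : ‖T x‖ = ‖w‖ := by rw [hTx', LinearIsometryEquiv.norm_map]
  have hsq : ‖w‖ ^ 2 ≤ (C * ‖x‖) ^ 2 := by
    rw [EuclideanSpace.norm_sq_eq, mul_pow, ← b.repr.norm_map x, EuclideanSpace.norm_sq_eq, Finset.mul_sum]
    refine Finset.sum_le_sum fun j _ => ?_
    rw [hwj, norm_mul, mul_pow, Complex.norm_real, Real.norm_eq_abs]
    have hj : |hA.eigenvalues j| ^ 2 ≤ C ^ 2 := pow_le_pow_left₀ (abs_nonneg _) (h j) 2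
    exact mul_le_mul_of_nonneg_right hj (sq_nonneg _)
  rw [hnorm]
  exact (pow_le_pow_iff_left₀ (norm_nonneg _) (by positivity) two_ne_zero).mp hsq

/-- `‖A‖ = max_j |λ_j(A)|`: some eigenvalue of a Hermitian matrix has modulus equal to the operator norm (`N ≥ 1`). [folklore] -/
private theorem exists_abs_eigenvalues_eq_l2_opNorm [Nonempty n] {A : Matrix n n ℂ} (hA : A.IsHermitian) :
    ∃ j, |hA.eigenvalues j| = ‖A‖ := by
  obtain ⟨j₀, -, hj₀⟩ :=
    Finset.exists_max_image Finset.univ (fun j => |hA.eigenvalues j|) Finset.univ_nonempty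
  exact ⟨j₀, le_antisymm (abs_eigenvalues_le_l2_opNorm hA j₀)
    (l2_opNorm_le_of_abs_eigenvalues_le hA (abs_nonneg _) fun j => hj₀ j (Finset.mem_univ j))⟩

/-- **RAYLEIGH–RITZ, `‖A‖ = λ_max(A)` for a positive semidefinite matrix**: some eigenvalue of `A` EQUALS the L²-operator norm
(`N ≥ 1`). [cite: HornJohnson2013, Thm. 4.2.2 (c) with §5.6 (spectral norm)] -/
theorem exists_eigenvalues_eq_l2_opNorm_of_posSemidef [Nonempty n] {A : Matrix n n ℂ} (hA : A.PosSemidef) :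
    ∃ j, hA.1.eigenvalues j = ‖A‖ := by
  obtain ⟨j, hj⟩ := exists_abs_eigenvalues_eq_l2_opNorm hA.1
  exact ⟨j, by rwa [abs_of_nonneg (hA.eigenvalues_nonneg j)] at hj⟩

/-- An eigenvalue `λ_j` of a Hermitian matrix `A` is a root of the characteristic polynomial: `det(λ_j·1 − A) = 0` (the unit
eigenvector `b_j` lies in the kernel of `λ_j·1 − A`). [cite: HornJohnson2013, Observation 1.1.7 and §1.2 (σ(A) = the roots of
p_A(t) = det(tI − A))] -/
theorem det_eigenvalues_smul_one_sub_eq_zero {A : Matrix n n ℂ} (hA : A.IsHermitian) (j : n) :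
    ((hA.eigenvalues j : ℂ) • (1 : Matrix n n ℂ) - A).det = 0 := by
  rw [← Matrix.exists_mulVec_eq_zero_iff]
  refine ⟨⇑(hA.eigenvectorBasis j), ?_, ?_⟩
  · intro h0
    have h1 : ‖(hA.eigenvectorBasis j : EuclideanSpace ℂ n)‖ = 1 := hA.eigenvectorBasis.orthonormal.1 j
    have h2 : (hA.eigenvectorBasis j : EuclideanSpace ℂ n) = 0 :=
      PiLp.ext fun i => by simpa using congrFun h0 i
    rw [h2, norm_zero] at h1
    exact zero_ne_one h1
  · rw [Matrix.sub_mulVec, Matrix.smul_mulVec, Matrix.one_mulVec, hA.mulVec_eigenvectorBasis j, sub_eq_zero]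
    funext i
    rw [Pi.smul_apply, Pi.smul_apply, smul_eq_mul, Complex.real_smul]

/-- **`det(‖A‖²·1 − AᴴA) = 0`** for every `A ∈ M_N(ℂ)`, `N ≥ 1`: `‖AᴴA‖ = ‖A‖²` (C⋆-identity) is the top eigenvalue of the
positive semidefinite `AᴴA`. [cite: HornJohnson2013, Thm. 4.2.2 (c) / §5.6 (‖A‖₂² = λ_max(A*A))] -/
theorem det_normSq_smul_one_sub_conjTranspose_mul_self [Nonempty n] (A : Matrix n n ℂ) :
    (((‖A‖ ^ 2 : ℝ) : ℂ) • (1 : Matrix n n ℂ) - A.conjTranspose * A).det = 0 := by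
  have hP : (A.conjTranspose * A).PosSemidef := Matrix.posSemidef_conjTranspose_mul_self A
  obtain ⟨j, hj⟩ := exists_eigenvalues_eq_l2_opNorm_of_posSemidef hP
  rw [Matrix.l2_opNorm_conjTranspose_mul_self, ← sq] at hj
  rw [← hj]
  exact det_eigenvalues_smul_one_sub_eq_zero hP.1 j

/-- **THE LEVEL EQUATION OF THE `dist1`-SPHERE**: for a unitary `W` with `‖W − 1‖ = r` (L²-operator norm = print's `|W − 1|`),
`det((r² − 2)·1 + W + Wᴴ) = 0` — since `(W − 1)ᴴ(W − 1) = 2·1 − W − Wᴴ` and `det(r²·1 − (W − 1)ᴴ(W − 1)) = 0`.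
[cite: Balaban1985Averaging, (19) p.21] [cite: HornJohnson2013, §5.6 / Thm. 4.2.2 (c)] -/
theorem det_level_eq_zero_of_norm_sub_one_eq [Nonempty n] {W : Matrix n n ℂ} (hW : W ∈ Matrix.unitaryGroup n ℂ)
    {r : ℝ} (hr : ‖W - 1‖ = r) :
    (((r ^ 2 - 2 : ℝ) : ℂ) • (1 : Matrix n n ℂ) + W + W.conjTranspose).det = 0 := by
  have h := det_normSq_smul_one_sub_conjTranspose_mul_self (W - 1)
  have hWW : W.conjTranspose * W = 1 := by
    have := Matrix.mem_unitaryGroup_iff'.mp hW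
    rwa [Matrix.star_eq_conjTranspose] at this
  have key : (W - 1).conjTranspose * (W - 1) = (2 : ℂ) • (1 : Matrix n n ℂ) - W - W.conjTranspose := by
    rw [Matrix.conjTranspose_sub, Matrix.conjTranspose_one, sub_mul, one_mul, mul_sub, mul_one, hWW, two_smul]
    abel
  rw [hr, key] at h
  have heq : (((r ^ 2 - 2 : ℝ) : ℂ)) • (1 : Matrix n n ℂ) + W + W.conjTranspose =
      ((r ^ 2 : ℝ) : ℂ) • (1 : Matrix n n ℂ) - ((2 : ℂ) • (1 : Matrix n n ℂ) - W - W.conjTranspose) := by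
    rw [Complex.ofReal_sub, sub_smul]
    push_cast
    abel
  rw [heq]
  exact h

/-- **SET FORM, for any unitary-valued map** `w : X → M_N(ℂ)` (a bond word, a contour holonomy …): the threshold set
`{x : ‖w x − 1‖ = r}` lies in the level set `{x : det((r² − 2)·1 + w x + (w x)ᴴ) = 0}` — the form in which an analytic zero-set
theorem reaches operator-norm thresholds. [cite: Balaban1985Averaging, (19) p.21] [cite: HornJohnson2013, §5.6] -/
theorem setOf_norm_sub_one_eq_subset_setOf_det_level [Nonempty n] {X : Type*} {w : X → Matrix n n ℂ}
    (hw : ∀ x, w x ∈ Matrix.unitaryGroup n ℂ) (r : ℝ) :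
    {x : X | ‖w x - 1‖ = r} ⊆ {x : X | (((r ^ 2 - 2 : ℝ) : ℂ) • (1 : Matrix n n ℂ) + w x + (w x).conjTranspose).det = 0} :=
  fun x hx => det_level_eq_zero_of_norm_sub_one_eq (hw x) hx

end Level

/-! ## §2 `M ↦ det(c·1 + M + Mᴴ)` is real-analytic on `M_N(ℂ)` and non-zero at `M = 1` -/

section Analytic

/-- `det M` is the evaluation at the entries of `M` of the determinant of the generic matrix `(X_{ij})`. [folklore] -/
private theorem det_eq_eval_mvPolynomialX (M : Matrix n n ℂ) :
    M.det = MvPolynomial.eval (fun p : n × n => M p.1 p.2) (Matrix.mvPolynomialX n n ℂ).det := by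
  rw [RingHom.map_det, Matrix.mvPolynomialX_mapMatrix_eval]

/-- `det` is analytic on `M_N(ℂ)` (a polynomial in the entries). [folklore] -/
private theorem analyticOnNhd_det : AnalyticOnNhd ℂ (fun M : Matrix n n ℂ => M.det) Set.univ := by
  let e : Matrix n n ℂ →L[ℂ] (n × n → ℂ) :=
    LinearMap.toContinuousLinearMap
      { toFun := fun A p => A p.1 p.2
        map_add' := fun _ _ => rfl
        map_smul' := fun _ _ => rfl }
  have h := AnalyticOnNhd.eval_continuousLinearMap e (Matrix.mvPolynomialX n n ℂ).det
  have heq : (fun M : Matrix n n ℂ => M.det) = fun M => MvPolynomial.eval (e M) (Matrix.mvPolynomialX n n ℂ).det :=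
    funext fun M => det_eq_eval_mvPolynomialX M
  rw [heq]; exact h

/-- **`M ↦ det(c·1 + M + Mᴴ)` is real-analytic on all of `M_N(ℂ)`** (a polynomial in the entries and their conjugates:
`det` is complex-analytic, `M ↦ Mᴴ` is real-linear and continuous — Mathlib `starL' ℝ`). [cite: HornJohnson2013, §0.3
(the determinant) and §0.2.5 (the conjugate transpose)] -/
theorem analyticOnNhd_det_level (c : ℂ) :
    AnalyticOnNhd ℝ (fun M : Matrix n n ℂ => (c • (1 : Matrix n n ℂ) + M + M.conjTranspose).det) Set.univ := by
  intro M _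
  have hstar : AnalyticAt ℝ (fun A : Matrix n n ℂ => A.conjTranspose) M := by
    have h := ((starL' ℝ : Matrix n n ℂ ≃L[ℝ] Matrix n n ℂ) : Matrix n n ℂ →L[ℝ] Matrix n n ℂ).analyticAt M
    refine h.congr (Filter.Eventually.of_forall fun A => ?_)
    show (starL' ℝ : Matrix n n ℂ ≃L[ℝ] Matrix n n ℂ) A = A.conjTranspose
    rw [starL'_apply, Matrix.star_eq_conjTranspose]
  have h1 : AnalyticAt ℝ (fun A : Matrix n n ℂ => c • (1 : Matrix n n ℂ) + A + A.conjTranspose) M :=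
    (analyticAt_const.add analyticAt_id).add hstar
  exact ((analyticOnNhd_det _ (Set.mem_univ _)).restrictScalars (𝕜 := ℝ)).comp h1

/-- **COMPOSITE FORM**: if `P : E → M_N(ℂ)` is real-analytic on `s`, so is `x ↦ det(c·1 + P x + (P x)ᴴ)` — the shape consumed
by product-Haar zero-set theorems with `P` an ambient (polynomial) bond word. [cite: HornJohnson2013, §0.3 (the determinant)] -/
theorem analyticOnNhd_det_level_comp {E : Type*} [NormedAddCommGroup E] [NormedSpace ℝ E] {P : E → Matrix n n ℂ}
    {s : Set E} (hP : AnalyticOnNhd ℝ P s) (c : ℂ) :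
    AnalyticOnNhd ℝ (fun x : E => (c • (1 : Matrix n n ℂ) + P x + (P x).conjTranspose).det) s :=
  fun x hx => ((analyticOnNhd_det_level c) _ (Set.mem_univ _)).comp (hP x hx)

/-- **THE WITNESS AT THE UNIT CONFIGURATION**: `det(c·1 + 1 + 1ᴴ) = (c + 2)^N ≠ 0` whenever `c + 2 ≠ 0` — with `c = r² − 2` this is
`(r²)^N ≠ 0` for `r ≠ 0`, so the level function is not identically zero on any product of unitary groups (value at `U ≡ 1`).
[cite: HornJohnson2013, §0.3 (det(cI) = c^N)] -/
theorem det_level_one_ne_zero {c : ℂ} (hc : c + 2 ≠ 0) :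
    (c • (1 : Matrix n n ℂ) + 1 + (1 : Matrix n n ℂ).conjTranspose).det ≠ 0 := by
  rw [Matrix.conjTranspose_one,
    show c • (1 : Matrix n n ℂ) + 1 + 1 = (c + 2) • (1 : Matrix n n ℂ) by rw [add_smul, two_smul]; abel,
    Matrix.det_smul, Matrix.det_one, mul_one]
  exact pow_ne_zero _ hc

/-- The constant of the sphere of radius `r ≠ 0`: `(r² − 2) + 2 = r² ≠ 0` in `ℂ`. [cite: Balaban1985Averaging, (19) p.21 (bookkeeping)] -/
theorem level_const_add_two_ne_zero {r : ℝ} (hr : r ≠ 0) : ((r ^ 2 - 2 : ℝ) : ℂ) + 2 ≠ 0 := by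
  rw [← Complex.ofReal_ofNat, ← Complex.ofReal_add, sub_add_cancel, Complex.ofReal_ne_zero]
  exact pow_ne_zero 2 hr

end Analytic

/-! ## §3 Spheres about any centre are Haar-null -/

section Centre

/-- **`μ{u ∈ U(N) : ‖u − V‖ = r} = 0`** for every centre `V ∈ U(N)`, every Haar measure `μ` on `U(N)` and every `r ≠ 0`: left
translation, `‖u − V‖ = ‖V⁻¹u − 1‖` (the L²-operator norm is unitarily invariant), over the landed one-centre theorem
`HaarEigenvalueSphereNull.haar_unitaryGroup_setOf_norm_sub_one_eq_eq_zero`. [cite: BrockerTomDieck1985, IV (2.11) (proof)]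
[cite: Balaban1985Averaging, (19) p.21] -/
theorem haar_unitaryGroup_setOf_norm_sub_eq_eq_zero {N : ℕ} (μ : Measure (Matrix.unitaryGroup (Fin N) ℂ)) [μ.IsHaarMeasure]
    (V : Matrix.unitaryGroup (Fin N) ℂ) {r : ℝ} (hr : r ≠ 0) :
    μ {u : Matrix.unitaryGroup (Fin N) ℂ | ‖(u : Matrix (Fin N) (Fin N) ℂ) - V‖ = r} = 0 := by
  have hset : {u : Matrix.unitaryGroup (Fin N) ℂ | ‖(u : Matrix (Fin N) (Fin N) ℂ) - V‖ = r} =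
      (fun u => V⁻¹ * u) ⁻¹' {u : Matrix.unitaryGroup (Fin N) ℂ | ‖(u : Matrix (Fin N) (Fin N) ℂ) - 1‖ = r} := by
    ext u
    simp only [Set.mem_setOf_eq, Set.mem_preimage]
    have hVV : ((V⁻¹ : Matrix.unitaryGroup (Fin N) ℂ) : Matrix (Fin N) (Fin N) ℂ) * (V : Matrix (Fin N) (Fin N) ℂ) = 1 := by
      rw [← Matrix.UnitaryGroup.mul_val, inv_mul_cancel]; rfl
    have hVu : (((V⁻¹ * u : Matrix.unitaryGroup (Fin N) ℂ)) : Matrix (Fin N) (Fin N) ℂ) - 1 =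
        ((V⁻¹ : Matrix.unitaryGroup (Fin N) ℂ) : Matrix (Fin N) (Fin N) ℂ) * ((u : Matrix (Fin N) (Fin N) ℂ) - V) := by
      rw [mul_sub, hVV, Matrix.UnitaryGroup.mul_val]
    rw [hVu, CStarRing.norm_coe_unitary_mul]
  rw [hset, measure_preimage_mul]
  exact haar_unitaryGroup_setOf_norm_sub_one_eq_eq_zero μ hr

/-- **`μ{g ∈ SU(n) : ‖g − V‖ = r} = 0`** for every centre `V ∈ SU(n)`, every Haar measure `μ` on `SU(n)` and every `r ≠ 0`.
[cite: BrockerTomDieck1985, IV (2.11) (proof)] [cite: Balaban1985Averaging, (19) p.21] -/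
theorem haar_specialUnitaryGroup_setOf_norm_sub_eq_eq_zero (μ : Measure (Matrix.specialUnitaryGroup n ℂ)) [μ.IsHaarMeasure]
    (V : Matrix.specialUnitaryGroup n ℂ) {r : ℝ} (hr : r ≠ 0) :
    μ {g : Matrix.specialUnitaryGroup n ℂ | ‖(g : Matrix n n ℂ) - V‖ = r} = 0 := by
  have hset : {g : Matrix.specialUnitaryGroup n ℂ | ‖(g : Matrix n n ℂ) - V‖ = r} =
      (fun g => V⁻¹ * g) ⁻¹' {g : Matrix.specialUnitaryGroup n ℂ | ‖(g : Matrix n n ℂ) - 1‖ = r} := by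
    ext g
    simp only [Set.mem_setOf_eq, Set.mem_preimage]
    have hVV : ((V⁻¹ : Matrix.specialUnitaryGroup n ℂ) : Matrix n n ℂ) * (V : Matrix n n ℂ) = 1 := by
      rw [← Submonoid.coe_mul, inv_mul_cancel]; rfl
    have hVg : (((V⁻¹ * g : Matrix.specialUnitaryGroup n ℂ)) : Matrix n n ℂ) - 1 =
        ((V⁻¹ : Matrix.specialUnitaryGroup n ℂ) : Matrix n n ℂ) * ((g : Matrix n n ℂ) - V) := by
      rw [mul_sub, hVV, Submonoid.coe_mul]
    rw [hVg, CStarRing.norm_mem_unitary_mul _ (V⁻¹).2.1]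
  rw [hset, measure_preimage_mul]
  exact haar_specialUnitaryGroup_setOf_norm_sub_one_eq_eq_zero μ hr

end Centre

/-! ## §4 Countable families of radii; the `GaugeGroup` ∕ `HaarData` currency of `UnitaryModel` -/

section Countable

/-- **`μ{u ∈ U(N) : ‖u − 1‖ ∈ R} = 0`** for every COUNTABLE set `R` of radii with `0 ∉ R` and every Haar measure `μ`
(`measure_biUnion_null_iff` over the one-radius theorem). [cite: BrockerTomDieck1985, IV (2.11) (proof)] [cite: Balaban1985Averaging, (19) p.21] -/
theorem haar_unitaryGroup_setOf_norm_sub_one_mem_eq_zero {N : ℕ} (μ : Measure (Matrix.unitaryGroup (Fin N) ℂ))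
    [μ.IsHaarMeasure] {R : Set ℝ} (hR : R.Countable) (hR0 : (0 : ℝ) ∉ R) :
    μ {u : Matrix.unitaryGroup (Fin N) ℂ | ‖(u : Matrix (Fin N) (Fin N) ℂ) - 1‖ ∈ R} = 0 := by
  have hset : {u : Matrix.unitaryGroup (Fin N) ℂ | ‖(u : Matrix (Fin N) (Fin N) ℂ) - 1‖ ∈ R} =
      ⋃ r ∈ R, {u : Matrix.unitaryGroup (Fin N) ℂ | ‖(u : Matrix (Fin N) (Fin N) ℂ) - 1‖ = r} := by
    ext u
    simp only [Set.mem_setOf_eq, Set.mem_iUnion, exists_prop, exists_eq_right']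
  rw [hset, measure_biUnion_null_iff hR]
  intro r hrR
  exact haar_unitaryGroup_setOf_norm_sub_one_eq_eq_zero μ (by rintro rfl; exact hR0 hrR)

/-- **`μ{g ∈ SU(n) : ‖g − 1‖ ∈ R} = 0`** for every COUNTABLE set `R` of radii with `0 ∉ R` and every Haar measure `μ`.
[cite: BrockerTomDieck1985, IV (2.11) (proof)] [cite: Balaban1985Averaging, (19) p.21] -/
theorem haar_specialUnitaryGroup_setOf_norm_sub_one_mem_eq_zero (μ : Measure (Matrix.specialUnitaryGroup n ℂ))
    [μ.IsHaarMeasure] {R : Set ℝ} (hR : R.Countable) (hR0 : (0 : ℝ) ∉ R) :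
    μ {g : Matrix.specialUnitaryGroup n ℂ | ‖(g : Matrix n n ℂ) - 1‖ ∈ R} = 0 := by
  have hset : {g : Matrix.specialUnitaryGroup n ℂ | ‖(g : Matrix n n ℂ) - 1‖ ∈ R} =
      ⋃ r ∈ R, {g : Matrix.specialUnitaryGroup n ℂ | ‖(g : Matrix n n ℂ) - 1‖ = r} := by
    ext g
    simp only [Set.mem_setOf_eq, Set.mem_iUnion, exists_prop, exists_eq_right']
  rw [hset, measure_biUnion_null_iff hR]
  intro r hrR
  exact haar_specialUnitaryGroup_setOf_norm_sub_one_eq_eq_zero μ (by rintro rfl; exact hR0 hrR)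

/-- **ALL THRESHOLDS AT ONCE, IN THE CELL'S CURRENCY: `Haar{g ∈ SU(n) : dist1 g ∈ R} = 0`** for every countable `R ∌ 0`
(`dist1 g = ‖g − 1‖_{L²-op}`, `HaarData.haar` = the normalised Haar measure of `UnitaryModel`) — e.g. `R = {ε₀L^{−2k}} ∪ {ε_k} ∪ {δ_k}`,
the thresholds of every level of the multi-scale scheme. [cite: Balaban1985Averaging, (19) p.21] [cite: BrockerTomDieck1985, IV (2.11) (proof)] -/
theorem haar_setOf_dist1_mem_eq_zero_specialUnitaryGroup [Nonempty n] {R : Set ℝ} (hR : R.Countable) (hR0 : (0 : ℝ) ∉ R) :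
    (HaarData.haar : Measure (Matrix.specialUnitaryGroup n ℂ)) {g | dist1 g ∈ R} = 0 := by
  haveI : (HaarData.haar : Measure (Matrix.specialUnitaryGroup n ℂ)).IsHaarMeasure := Measure.isHaarMeasure_haarMeasure _
  exact haar_specialUnitaryGroup_setOf_norm_sub_one_mem_eq_zero _ hR hR0

/-- Almost-everywhere form on `SU(n)`: Haar-a.e. `g` avoids EVERY radius of the countable family, `∀ r ∈ R, dist1 g ≠ r`.
[cite: Balaban1985Averaging, (19) p.21] -/
theorem ae_forall_dist1_ne_specialUnitaryGroup [Nonempty n] {R : Set ℝ} (hR : R.Countable) (hR0 : (0 : ℝ) ∉ R) :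
    ∀ᵐ g ∂(HaarData.haar : Measure (Matrix.specialUnitaryGroup n ℂ)), ∀ r ∈ R, dist1 g ≠ r := by
  have h := haar_setOf_dist1_mem_eq_zero_specialUnitaryGroup (n := n) hR hR0
  rw [← compl_mem_ae_iff] at h
  filter_upwards [h] with g hg r hrR hgr
  exact hg (show dist1 g ∈ R by rw [hgr]; exact hrR)

/-- **`Haar{u ∈ U(N) : dist1 u ∈ R} = 0`** for every countable `R ∌ 0`, in the `GaugeGroup`∕`HaarData` currency of `UnitaryModel`.
[cite: Balaban1985Averaging, (19) p.21] [cite: BrockerTomDieck1985, IV (2.11) (proof)] -/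
theorem haar_setOf_dist1_mem_eq_zero_unitaryGroup {N : ℕ} [Nonempty (Fin N)] {R : Set ℝ} (hR : R.Countable)
    (hR0 : (0 : ℝ) ∉ R) :
    (HaarData.haar : Measure (Matrix.unitaryGroup (Fin N) ℂ)) {u | dist1 u ∈ R} = 0 := by
  haveI : (HaarData.haar : Measure (Matrix.unitaryGroup (Fin N) ℂ)).IsHaarMeasure := Measure.isHaarMeasure_haarMeasure _
  exact haar_unitaryGroup_setOf_norm_sub_one_mem_eq_zero _ hR hR0

end Countable

end Literature.MathematicalPhysics.QuantumFieldTheory.Balaban1983to89.HaarDist1LevelHypersurface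

end
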